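import Literature.NumberTheory.Automorphic.UnboundedDenominatorsReductions
import Literature.NumberTheory.Automorphic.UnboundedDenominatorsGammaInvariance
import HarnessLib

/-!
# The unbounded denominators theorem (Calegari–Dimitrov–Tang) — §4.2: the fields `M_N ⊆ R_N`

DEFINITIONS instalment of the formalization of F. Calegari, V. Dimitrov, Y. Tang, *The unbounded
denominators conjecture*, J. Amer. Math. Soc. **38** (2025), 627–702 = arXiv:2109.09040, §4.2
(Definition 4.2.1, Lemmas 4.2.2–4.2.3; arXiv v1: Definition 22, Lemmas 23–24), companion of the
named fact `Literature/NumberTheory/Automorphic/UnboundedDenominators.lean` and of its PROOF-ONLY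
siblings (`UnboundedDenominatorsReductions.lean`: the fact ⟺ its core case
`…iff_core_wohlfahrtLevel`; `UnboundedDenominatorsProofs.lean`, `…LeveragingProofs.lean`, …: the
leveraging argument of §§4.2–4.6 in hypothesis form; `UnboundedDenominatorsDimensionBoundProofs.lean`:
Proposition 3.0.1). What those files could not state — because it needs DEFINITIONS — is the object
the whole of CDT §4 is about:

> **Definition 4.2.1.** Let `M_N` denote the `ℚ(λ)`-vector space generated by holomorphic modular
> functions on the modular curve `Y(N) = ℍ/⟨E, Γ(N)⟩` with coefficients in `ℚ` at the cusp `ζ = i∞`.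
> Let `R_N` denote the `ℚ(λ)`-vector space generated by holomorphic modular functions with
> coefficients in `ℚ`, bounded denominators at the cusp `ζ = i∞`, and cusp widths dividing `N` at
> all cusps. **Lemma 4.2.3.** The vector spaces `M_N` and `R_N` are fields … `M_2 → M_N → R_N`. …
> "Our goal is to prove that `R_N = M_N`."

and §6.3: "`R_N = M_N` for every `N`, that is, the unbounded denominators conjecture holds."

## Design (recorded in the crux memo `Lines/cdt_thm1-RN-instalment-design-g37.md` of K★ 22226)

* **Carrier.** `hol` = the `ℂ`-subalgebra `𝓗 ⊆ (ℍ → ℂ)` of holomorphic functions (`MDifferentiable`),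
  an integral domain by the identity theorem (Mathlib `UpperHalfPlane.mul_eq_zero_iff`), and
  `Mer := FractionRing 𝓗`, a field containing every meromorphic quotient of holomorphic functions on
  `ℍ` — in particular CDT's `ℚ(λ) = M_2` and all modular functions. Coefficients are taken in `ℂ`
  (CDT work over `ℚ(λ)`, and over `K(λ)` for a number field `K` in §6.3; all degree computations of
  §4.3 are insensitive to the base change, while Galois theory of `M_{Np}/M_N` needs `ℂ`).
* **Action.** `SL(2, ℤ)` acts on `𝓗` by the weight-`0` (left) action `(γ • f)(τ) = f(γ⁻¹ • τ)`,
  by `ℂ`-algebra automorphisms, and hence on `Mer` (Mathlib `IsFractionRing.mulSemiringAction`);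
  `invariantField Γ` is the fixed field of `Γ ≤ SL(2, ℤ)` (an `IntermediateField ℂ Mer`).
* **Modular functions.** `modFun m F := F/Δᵐ ∈ 𝓗` for a modular form `F` (CDT, proof of Lemma 4.2.2:
  "the modular form `f Δ(τ)ᵐ` is holomorphic at the cusps for sufficiently large `m`" — every
  holomorphic modular function with poles only at cusps is of this form, `Δ = η²⁴` vanishing nowhere
  on `ℍ`); for `F ∈ M_{12m}(Γ)` it is `Γ`-invariant (`smul_modFun_of_mem`), and conversely
  `Γ(N)`-invariance of `F/Δᵐ` is `Γ(N)`-invariance of `F` in weight `12m`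
  (`slash_eq_of_forall_smul_modFun_eq`).
* **Generators and fields** (Definition 4.2.1 with `ℂ`-coefficients). `bddDenGens N` = the elements
  `F/Δᵐ` with `F ∈ M_{12m}(G)`, `G ≤ SL(2, ℤ)` of finite index containing every conjugate of `Tᴺ`
  ("cusp widths dividing `N`", CDT Def. 4.1.1 / tree `wohlfahrtLevel_dvd_iff`) and `F ∈ ℤ⟦q_N⟧`
  (rational-integer `q`-expansion at the period `N`; "bounded denominators" up to a harmless integer
  factor, which does not change the generated field); `levelGens N` = the same with `Γ(N) ≤ G`.
  `bddDenField N := ℂ(bddDenGens N)` is CDT's `R_N ⊗ ℂ` and `levelField N := ℂ(levelGens N)` is CDT's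
  `M_N ⊗ ℂ`, as intermediate fields of `Mer/ℂ` (so they ARE fields — CDT prove this in Lemma 4.2.3
  from finite-dimensionality; taking the generated field instead of the span makes it definitional,
  and the two agree as soon as the span is finite-dimensional over `ℂ(λ)`). With this choice
  `M_N ⊆ R_N` is immediate (`levelField_le_bddDenField`; CDT's Lemma 4.2.2 needs Shimura's bounded
  denominators theorem for `X(N)` because their `M_N` allows arbitrary rational `q`-expansions — that
  input is thereby moved into the degree formula (4.3.3) `[M_N : M_2] = ½[Γ(2) : Γ(N)]`, where it
  belongs).

## What is proved here (sorry-free)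

`IsDomain 𝓗`; the actions and their compatibility (`smul_algebraMap`); `mem_invariantField_iff`;
`Γ`-invariance of `F/Δᵐ` and its converse; `levelGens N ⊆ bddDenGens N`, monotonicity in `N`
(`bddDenGens_mono`, `levelGens_mono`), `levelField N ≤ bddDenField N`, `levelField N ≤ invariantField Γ(N)`
(**every element of `M_N` is `Γ(N)`-invariant**); the ENTRANCE of the core case
(`algebraMap_modFun_mem_bddDenGens`: the form `f` of `…iff_core_wohlfahrtLevel` gives
`f/Δᵐ ∈ R_{L(G)}`) and its EXIT (`exists_congruence_of_algebraMap_modFun_mem_levelField`: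
`f/Δᵐ ∈ M_N` forces `f` to be congruence); and the assembled reduction
★ `CalegariDimitrovTang2025_unboundedDenominators.of_bddDenField_le_levelField` —
**the unbounded denominators theorem follows from `R_N ⊆ M_N` for all even `N`** (CDT §6.3 / the
sentence "Our goal is to prove that `R_N = M_N`. We can and do assume that `N` is even.").
Nothing here proves `R_N = M_N`; the degree theory ([R_N : M_N], (4.3.3), Theorem 4.3.2,
Proposition 4.3.3 with the holonomy bound) is the business of the sequel files.

## References

* [CalegariDimitrovTang2025] F. Calegari, V. Dimitrov, Y. Tang, The unbounded denominators
  conjecture, J. Amer. Math. Soc. 38 (2025), no. 3, 627–702; arXiv:2109.09040. §4.2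
  (Definition 4.2.1, Lemmas 4.2.2, 4.2.3), §6.3.
-/

noncomputable section

namespace Literature.NumberTheory.Automorphic

open scoped MatrixGroups ModularForm Manifold
open UpperHalfPlane CongruenceSubgroup Matrix.SpecialLinearGroup ModularGroup

namespace UnboundedDenominators

/-! ### §1. The algebra `𝓗` of holomorphic functions on `ℍ` and its fraction field -/

/-- The `ℂ`-algebra `𝓗` of holomorphic functions `ℍ → ℂ` (Mathlib: `MDifferentiable` for the complex
structure of `ℍ`), as a subalgebra of all functions. The ambient ring in which CDT's modular functions
`f/Δᵐ` live. [cite: CalegariDimitrovTang2025, §4.2 (proof of Lemma 4.2.2)] -/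
def hol : Subalgebra ℂ (ℍ → ℂ) where
  carrier := {f | MDiff f}
  mul_mem' hf hg := hf.mul hg
  add_mem' hf hg := hf.add hg
  algebraMap_mem' c := by
    change MDiff fun _ : ℍ ↦ (algebraMap ℂ ℂ c)
    exact mdifferentiable_const

/-- Membership in `𝓗` is holomorphy. [cite: CalegariDimitrovTang2025, Definition 4.2.1 (setting)] -/
theorem mem_hol {f : ℍ → ℂ} : f ∈ hol ↔ MDiff f := Iff.rfl

/-- Elements of `𝓗` are holomorphic. [cite: CalegariDimitrovTang2025, Definition 4.2.1 (setting)] -/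
theorem mdifferentiable_coe_hol (f : hol) : MDiff (f : ℍ → ℂ) := f.2

/-- **`𝓗` is an integral domain** (identity theorem on the connected `ℍ`; Mathlib
`UpperHalfPlane.mul_eq_zero_iff`). This is CDT's remark "`M_N` and `R_N` are subspaces of
`ℚ((q^{1/N}))`, which is a domain" transported to functions. [cite: CalegariDimitrovTang2025,
proof of Lemma 4.2.3] -/
instance instNoZeroDivisorsHol : NoZeroDivisors hol where
  eq_zero_or_eq_zero_of_mul_eq_zero {a b} h := by
    have h' : (a : ℍ → ℂ) * b = 0 := congrArg Subtype.val h
    rcases (UpperHalfPlane.mul_eq_zero_iff a.2 b.2).mp h' with ha | hb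
    · exact Or.inl (Subtype.ext ha)
    · exact Or.inr (Subtype.ext hb)

/-- `𝓗` is an integral domain ("`ℚ((q^{1/N}))` … is a domain").
[cite: CalegariDimitrovTang2025, proof of Lemma 4.2.3] -/
instance instIsDomainHol : IsDomain hol := NoZeroDivisors.to_isDomain _

/-- The field `Mer = Frac 𝓗` of quotients of holomorphic functions on `ℍ` (a field of meromorphic
functions on `ℍ`), the common home of CDT's `M_2 = ℚ(λ) ⊆ M_N ⊆ R_N`.
[cite: CalegariDimitrovTang2025, Definition 4.2.1] -/
abbrev Mer : Type := FractionRing hol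

/-- `𝓗 → Mer` is injective (modular functions embed in the field `Mer`). [cite: CalegariDimitrovTang2025, Definition 4.2.1 (setting)] -/
theorem algebraMap_hol_injective : Function.Injective (algebraMap hol Mer) :=
  IsFractionRing.injective hol Mer

/-! ### §2. The weight-`0` action of `SL(2, ℤ)` -/

/-- `τ ↦ γ • τ` is holomorphic on `ℍ` for `γ ∈ SL(2, ℤ)`. [folklore] -/
private theorem mdifferentiable_sl_smul (γ : SL(2, ℤ)) : MDiff fun τ : ℍ ↦ γ • τ := by
  have h : MDiff fun τ : ℍ ↦ (γ : GL (Fin 2) ℝ) • τ :=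
    UpperHalfPlane.mdifferentiable_smul (g := (γ : GL (Fin 2) ℝ)) (by simp)
  simpa only [sl_moeb] using h

/-- **The weight-`0` action of `SL(2, ℤ)` on `𝓗`**: `(γ • f)(τ) = f(γ⁻¹ • τ)` — a left action by
`ℂ`-algebra automorphisms (composition with the Möbius transformation `γ⁻¹`). A function is
`Γ`-invariant for `Γ ≤ SL(2, ℤ)` iff it is fixed by this action of `Γ`.
[cite: CalegariDimitrovTang2025, §4.2 ("holomorphic modular functions on `Y(N) = ℍ/⟨E, Γ(N)⟩`")] -/
instance instMulSemiringActionHol : MulSemiringAction SL(2, ℤ) hol where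
  smul γ f := ⟨fun τ ↦ (f : ℍ → ℂ) (γ⁻¹ • τ), f.2.comp (mdifferentiable_sl_smul γ⁻¹)⟩
  one_smul f := by
    ext τ
    change (f : ℍ → ℂ) ((1 : SL(2, ℤ))⁻¹ • τ) = (f : ℍ → ℂ) τ
    rw [inv_one, one_smul]
  mul_smul γ δ f := by
    ext τ
    change (f : ℍ → ℂ) ((γ * δ)⁻¹ • τ) = (f : ℍ → ℂ) (δ⁻¹ • γ⁻¹ • τ)
    rw [mul_inv_rev, mul_smul]
  smul_zero γ := by ext τ; rfl
  smul_add γ f g := by ext τ; rfl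
  smul_one γ := by ext τ; rfl
  smul_mul γ f g := by ext τ; rfl

/-- Pointwise formula for the weight-`0` action: `(γ • f)(τ) = f(γ⁻¹ • τ)`. [cite: CalegariDimitrovTang2025, Definition 4.2.1 (setting)] -/
@[simp] theorem smul_hol_apply (γ : SL(2, ℤ)) (f : hol) (τ : ℍ) :
    ((γ • f : hol) : ℍ → ℂ) τ = (f : ℍ → ℂ) (γ⁻¹ • τ) := rfl

/-- The action commutes with scalars. [folklore] -/
instance instSMulCommClassHol : SMulCommClass SL(2, ℤ) ℂ hol where
  smul_comm γ c f := by ext τ; rfl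

/-- The induced action of `SL(2, ℤ)` on `Mer = Frac 𝓗` by field automorphisms (Mathlib
`IsFractionRing.mulSemiringAction`). [folklore] -/
instance instMulSemiringActionMer : MulSemiringAction SL(2, ℤ) Mer :=
  IsFractionRing.mulSemiringAction SL(2, ℤ) hol Mer

/-- Compatibility of the two actions along `𝓗 → Mer`. [folklore] -/
instance instSMulDistribClassMer : SMulDistribClass SL(2, ℤ) hol Mer :=
  IsFractionRing.smulDistribClass SL(2, ℤ) hol Mer

/-- The action on `Mer` commutes with scalars. [folklore] -/
instance instSMulCommClassMer : SMulCommClass SL(2, ℤ) ℂ Mer :=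
  IsFractionRing.smulCommClass SL(2, ℤ) ℂ hol ℂ Mer

/-- `γ • ι(f) = ι(γ • f)` for `ι : 𝓗 → Mer`: the action on modular functions is computed on
functions. [cite: CalegariDimitrovTang2025, Definition 4.2.1 (setting)] -/
theorem smul_algebraMap (γ : SL(2, ℤ)) (f : hol) :
    γ • algebraMap hol Mer f = algebraMap hol Mer (γ • f) := by
  rw [Algebra.algebraMap_eq_smul_one, Algebra.algebraMap_eq_smul_one, smul_distrib_smul, smul_one]

/-- **The field of `Γ`-invariant elements of `Mer`**, for `Γ ≤ SL(2, ℤ)`: the fixed field of the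
image of `Γ` in `Aut_ℂ(Mer)` — an intermediate field of `Mer/ℂ`. For `Γ = ⟨E, Γ(N)⟩` it contains
CDT's `M_N` (`levelField_le_invariantField`). [cite: CalegariDimitrovTang2025, Definition 4.2.1] -/
def invariantField (Γ : Subgroup SL(2, ℤ)) : IntermediateField ℂ Mer :=
  IntermediateField.fixedField (Γ.map (MulSemiringAction.toAlgAut SL(2, ℤ) ℂ Mer))

/-- Membership in the invariant field: `x` is fixed by every `γ ∈ Γ` ("modular functions on
`ℍ/Γ`"). [cite: CalegariDimitrovTang2025, Definition 4.2.1 (setting)] -/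
theorem mem_invariantField_iff {Γ : Subgroup SL(2, ℤ)} {x : Mer} :
    x ∈ invariantField Γ ↔ ∀ γ ∈ Γ, γ • x = x := by
  rw [invariantField, IntermediateField.mem_fixedField_iff]
  constructor
  · intro h γ hγ
    simpa using h _ (Subgroup.mem_map_of_mem _ hγ)
  · rintro h _ ⟨γ, hγ, rfl⟩
    simpa using h γ hγ

/-- The invariant field is antitone in the group (a function on `ℍ/Γ'` is a function on `ℍ/Γ` for
`Γ ≤ Γ'`). [cite: CalegariDimitrovTang2025, Definition 4.2.1 (setting)] -/
theorem invariantField_anti {Γ Γ' : Subgroup SL(2, ℤ)} (h : Γ ≤ Γ') :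
    invariantField Γ' ≤ invariantField Γ := fun _ hx ↦
  mem_invariantField_iff.mpr fun γ hγ ↦ mem_invariantField_iff.mp hx γ (h hγ)

/-! ### §3. The modular functions `F/Δᵐ` -/

/-- `Δ` transforms with weight `12` under all of `SL(2, ℤ)`: `Δ(γ • τ) = (cτ + d)¹² Δ(τ)`.
[folklore] -/
private theorem discriminant_sl_smul (γ : SL(2, ℤ)) (τ : ℍ) :
    ModularForm.discriminant (γ • τ) = denom γ τ ^ (12 : ℤ) * ModularForm.discriminant τ := by
  have h := SlashInvariantForm.slash_action_eqn'' (CuspForm.discriminant)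
    (γ := (γ : GL (Fin 2) ℝ)) (MonoidHom.mem_range.mpr ⟨γ, rfl⟩) τ
  simpa only [CuspForm.coe_discriminant, sl_moeb] using h

/-- **The modular function `F/Δᵐ`** attached to a modular form `F` (any level, any weight): a
holomorphic function on `ℍ` since `Δ = η²⁴` does not vanish there. For `F ∈ M_{12m}(Γ)` this is a
"holomorphic modular function" for `Γ` in CDT's sense (weight `0`, poles only at cusps), and every
such function arises this way. [cite: CalegariDimitrovTang2025, proof of Lemma 4.2.2] -/
def modFun {Γ : Subgroup (GL (Fin 2) ℝ)} {k : ℤ} (m : ℕ) (F : ModularForm Γ k) : hol :=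
  ⟨⇑F / (⇑CuspForm.discriminant) ^ m,
    F.holo'.div (CuspForm.discriminant.holo'.pow m) fun τ ↦
      pow_ne_zero _ (ModularForm.discriminant_ne_zero τ)⟩

/-- Pointwise formula: `(F/Δᵐ)(τ) = F(τ)/Δ(τ)ᵐ`. [cite: CalegariDimitrovTang2025, proof of Lemma 4.2.2] -/
@[simp] theorem modFun_apply {Γ : Subgroup (GL (Fin 2) ℝ)} {k : ℤ} (m : ℕ) (F : ModularForm Γ k)
    (τ : ℍ) : (modFun m F : ℍ → ℂ) τ = F τ / ModularForm.discriminant τ ^ m := rfl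

/-- `F/Δᵐ` depends only on the underlying function of `F` (not on the level it is filed under).
[cite: CalegariDimitrovTang2025, proof of Lemma 4.2.2] -/
theorem modFun_eq_of_coe_eq {Γ Γ' : Subgroup (GL (Fin 2) ℝ)} {k k' : ℤ} (m : ℕ)
    {F : ModularForm Γ k} {F' : ModularForm Γ' k'} (h : (F : ℍ → ℂ) = F') :
    modFun m F = modFun m F' := by
  ext τ
  simp [h]

/-- **`F/Δᵐ` is `Γ`-invariant for `F ∈ M_{12m}(Γ)`**, pointwise: `(F/Δᵐ)(γ • τ) = (F/Δᵐ)(τ)` for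
`γ ∈ Γ ≤ SL(2, ℤ)` (the weights `(cτ+d)^{12m}` of `F` and of `Δᵐ` cancel).
[cite: CalegariDimitrovTang2025, §4.2 (Definition 4.2.1)] -/
theorem modFun_apply_smul_of_mem {Γ : Subgroup SL(2, ℤ)} {m : ℕ}
    (F : ModularForm (Γ : Subgroup (GL (Fin 2) ℝ)) (12 * (m : ℤ))) {γ : SL(2, ℤ)} (hγ : γ ∈ Γ)
    (τ : ℍ) : (modFun m F : ℍ → ℂ) (γ • τ) = (modFun m F : ℍ → ℂ) τ := by
  have hF : F (γ • τ) = denom γ τ ^ (12 * (m : ℤ)) * F τ :=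
    SlashInvariantForm.slash_action_eqn_SL'' F hγ τ
  have hd : denom γ τ ≠ 0 := denom_ne_zero γ τ
  have hΔ : ModularForm.discriminant τ ≠ 0 := ModularForm.discriminant_ne_zero τ
  rw [modFun_apply, modFun_apply, hF, discriminant_sl_smul, mul_pow, ← zpow_natCast,
    ← zpow_mul, mul_div_mul_left _ _ (zpow_ne_zero _ hd)]

/-- **`F/Δᵐ` is fixed by `Γ`** under the weight-`0` action, for `F ∈ M_{12m}(Γ)`, `Γ ≤ SL(2, ℤ)`.
[cite: CalegariDimitrovTang2025, §4.2 (Definition 4.2.1)] -/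
theorem smul_modFun_of_mem {Γ : Subgroup SL(2, ℤ)} {m : ℕ}
    (F : ModularForm (Γ : Subgroup (GL (Fin 2) ℝ)) (12 * (m : ℤ))) {γ : SL(2, ℤ)} (hγ : γ ∈ Γ) :
    γ • modFun m F = modFun m F := by
  ext τ
  rw [smul_hol_apply]
  exact modFun_apply_smul_of_mem F (inv_mem hγ) τ

/-- **Converse: `Γ'`-invariance of `F/Δᵐ` is `Γ'`-invariance of `F` in weight `12m`.** If
`γ • (F/Δᵐ) = F/Δᵐ` for all `γ` in a subgroup `Γ' ≤ SL(2, ℤ)`, then `F ∣_{12m} γ = F` for all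
`γ ∈ Γ'`. [cite: CalegariDimitrovTang2025, §6.3 ("`R_N = M_N` … that is, the unbounded denominators
conjecture holds")] -/
theorem slash_eq_of_forall_smul_modFun_eq {Γ : Subgroup (GL (Fin 2) ℝ)} {m : ℕ}
    (F : ModularForm Γ (12 * (m : ℤ))) {Γ' : Subgroup SL(2, ℤ)}
    (h : ∀ γ ∈ Γ', γ • modFun m F = modFun m F) {γ : SL(2, ℤ)} (hγ : γ ∈ Γ') :
    (⇑F : ℍ → ℂ) ∣[12 * (m : ℤ)] γ = ⇑F := by
  ext τ
  have hd : denom γ τ ≠ 0 := denom_ne_zero γ τ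
  have hΔ : ModularForm.discriminant τ ^ m ≠ 0 := pow_ne_zero _ (ModularForm.discriminant_ne_zero τ)
  -- `(F/Δᵐ)(γ • τ) = (F/Δᵐ)(τ)` from the hypothesis at `γ⁻¹`
  have key : F (γ • τ) / ModularForm.discriminant (γ • τ) ^ m =
      F τ / ModularForm.discriminant τ ^ m := by
    have := congrArg (fun g : hol ↦ (g : ℍ → ℂ) τ) (h γ⁻¹ (inv_mem hγ))
    simpa only [smul_hol_apply, inv_inv, modFun_apply] using this
  rw [discriminant_sl_smul, mul_pow, ← zpow_natCast (denom γ τ ^ (12 : ℤ)), ← zpow_mul,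
    div_eq_div_iff (mul_ne_zero (zpow_ne_zero _ hd) hΔ) hΔ] at key
  -- `key : F (γ • τ) * Δ τ ^ m = F τ * (denom ^ (12 m) * Δ τ ^ m)`
  have hFγ : F (γ • τ) = F τ * denom γ τ ^ (12 * (m : ℤ)) :=
    mul_right_cancel₀ hΔ (key.trans (mul_assoc _ _ _).symm)
  rw [ModularForm.SL_slash_apply, zpow_neg, mul_inv_eq_iff_eq_mul₀ (zpow_ne_zero _ hd), hFγ]

/-! ### §4. CDT's generators and the fields `M_N ⊆ R_N` (Definition 4.2.1) -/

/-- **Generators of `R_N`** [cite: CalegariDimitrovTang2025, Definition 4.2.1]: the elements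
`F/Δᵐ ∈ Mer` where `F` is a weight-`12m` modular form on a finite-index `G ≤ SL(2, ℤ)` containing
every conjugate of `Tᴺ` (all cusp widths of `G` divide `N`, i.e. `L(G) ∣ N`) whose `q`-expansion at
the period `N` has rational-integer coefficients ("holomorphic modular functions with coefficients in
`ℚ`, bounded denominators at `i∞`, and cusp widths dividing `N` at all cusps"; a bounded-denominator
function is an integer multiple of one of these, so the generated field is the same). -/
def bddDenGens (N : ℕ) : Set Mer :=
  {u | ∃ (G : Subgroup SL(2, ℤ)) (_ : G.FiniteIndex) (m : ℕ)
      (F : ModularForm (G : Subgroup (GL (Fin 2) ℝ)) (12 * (m : ℤ))),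
      (∀ g : SL(2, ℤ), g * T ^ N * g⁻¹ ∈ G) ∧
      (∀ n : ℕ, ∃ z : ℤ, PowerSeries.coeff n (qExpansion (N : ℝ) F) = (z : ℂ)) ∧
      u = algebraMap hol Mer (modFun m F)}

/-- **Generators of `M_N`** [cite: CalegariDimitrovTang2025, Definition 4.2.1]: as `bddDenGens N`
but with `G ⊇ Γ(N)` ("holomorphic modular functions on `Y(N) = ℍ/⟨E, Γ(N)⟩` with coefficients in `ℚ`
at `i∞`"; integrality of the `q`-expansion is built in — see the file docstring). -/
def levelGens (N : ℕ) : Set Mer :=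
  {u | ∃ (G : Subgroup SL(2, ℤ)) (_ : G.FiniteIndex) (m : ℕ)
      (F : ModularForm (G : Subgroup (GL (Fin 2) ℝ)) (12 * (m : ℤ))),
      Gamma N ≤ G ∧
      (∀ n : ℕ, ∃ z : ℤ, PowerSeries.coeff n (qExpansion (N : ℝ) F) = (z : ℂ)) ∧
      u = algebraMap hol Mer (modFun m F)}

/-- **CDT's field `R_N` (with `ℂ`-coefficients)**: the subfield of `Mer` generated over `ℂ` by
`bddDenGens N`. [cite: CalegariDimitrovTang2025, Definition 4.2.1 and Lemma 4.2.3] -/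
def bddDenField (N : ℕ) : IntermediateField ℂ Mer :=
  IntermediateField.adjoin ℂ (bddDenGens N)

/-- **CDT's field `M_N` (with `ℂ`-coefficients)**: the subfield of `Mer` generated over `ℂ` by
`levelGens N` — the function field of `X(N)` over `ℂ`, generated by its `ℚ`-rational elements.
[cite: CalegariDimitrovTang2025, Definition 4.2.1 and Lemma 4.2.3] -/
def levelField (N : ℕ) : IntermediateField ℂ Mer :=
  IntermediateField.adjoin ℂ (levelGens N)

/-- **Lemma 4.2.2, first half: `M_N ⊆ R_N`** at the level of generators (`Γ(N)` is normal and
contains `Tᴺ`, so a group containing `Γ(N)` contains every conjugate of `Tᴺ`).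
[cite: CalegariDimitrovTang2025, Lemma 4.2.2] -/
theorem levelGens_subset_bddDenGens (N : ℕ) : levelGens N ⊆ bddDenGens N := by
  rintro u ⟨G, hG, m, F, hle, hint, rfl⟩
  refine ⟨G, hG, m, F, fun g ↦ hle ?_, hint, rfl⟩
  have hT : T ^ N ∈ Gamma N := by
    have h := CongruenceSubgroup.ModularGroup_T_pow_mem_Gamma N N dvd_rfl
    rwa [Int.natAbs_natCast, zpow_natCast] at h
  exact (Gamma_normal N).conj_mem _ hT g

/-- **Lemma 4.2.2, first half: `M_N ⊆ R_N`.** [cite: CalegariDimitrovTang2025, Lemma 4.2.2] -/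
theorem levelField_le_bddDenField (N : ℕ) : levelField N ≤ bddDenField N :=
  IntermediateField.adjoin.mono ℂ _ _ (levelGens_subset_bddDenGens N)

/-- Integrality of the `q`-expansion passes from the period `N` to any multiple `N' = d N`
(the expansion in `q_{N'}` is that in `q_N` spread out). [folklore] -/
private theorem forall_coeff_int_of_dvd {G : Subgroup SL(2, ℤ)} {k : ℤ}
    (F : ModularForm (G : Subgroup (GL (Fin 2) ℝ)) k) {N N' : ℕ} (hN : 0 < N) (hTN : T ^ N ∈ G)
    (hd : N ∣ N') (hN' : N' ≠ 0)
    (hint : ∀ n : ℕ, ∃ z : ℤ, PowerSeries.coeff n (qExpansion (N : ℝ) F) = (z : ℂ)) :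
    ∀ n : ℕ, ∃ z : ℤ, PowerSeries.coeff n (qExpansion (N' : ℝ) F) = (z : ℂ) := by
  obtain ⟨d, rfl⟩ := hd
  have hd0 : d ≠ 0 := fun h ↦ hN' (by rw [h, mul_zero])
  have hper : ((N : ℕ) : ℝ) ∈ ((G : Subgroup SL(2, ℤ)) : Subgroup (GL (Fin 2) ℝ)).strictPeriods :=
    mem_strictPeriods_of_T_pow_mem hTN
  intro n
  have h := forall_coeff_qExpansion_natMul F (h := (N : ℝ)) (Nat.cast_pos.mpr hN) hper hd0
    (P := fun x : ℂ ↦ ∃ z : ℤ, x = (z : ℂ)) ⟨0, by simp⟩ hint n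
  simpa only [Nat.cast_mul, mul_comm (d : ℝ)] using h

/-- **Monotonicity of `R_N` in `N`** at the level of generators: `bddDenGens N ⊆ bddDenGens N'` for
`N ∣ N'`, `N' ≠ 0` ("`R_N ⊆ R_{Np}`", used throughout §4.3). [cite: CalegariDimitrovTang2025, §4.3] -/
theorem bddDenGens_mono {N N' : ℕ} (hN : 0 < N) (hd : N ∣ N') (hN' : N' ≠ 0) :
    bddDenGens N ⊆ bddDenGens N' := by
  rintro u ⟨G, hG, m, F, hT, hint, rfl⟩
  have hTN : T ^ N ∈ G := by simpa using hT 1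
  refine ⟨G, hG, m, F, fun g ↦ ?_, forall_coeff_int_of_dvd F hN hTN hd hN' hint, rfl⟩
  obtain ⟨d, rfl⟩ := hd
  rw [pow_mul]
  have : g * (T ^ N) ^ d * g⁻¹ = (g * T ^ N * g⁻¹) ^ d := by rw [conj_pow]
  rw [this]
  exact pow_mem (hT g) d

/-- `Γ(N') ≤ Γ(N)` for `N ∣ N'` (reduction of the congruences modulo `N'` to `N`). [folklore] -/
private theorem Gamma_le_Gamma_of_dvd {N N' : ℕ} (h : N ∣ N') : Gamma N' ≤ Gamma N := by
  intro A hA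
  rw [Gamma_mem] at hA ⊢
  obtain ⟨h00, h01, h10, h11⟩ := hA
  have c00 := congrArg (ZMod.castHom h (ZMod N)) h00
  have c01 := congrArg (ZMod.castHom h (ZMod N)) h01
  have c10 := congrArg (ZMod.castHom h (ZMod N)) h10
  have c11 := congrArg (ZMod.castHom h (ZMod N)) h11
  rw [map_intCast, map_one] at c00 c11
  rw [map_intCast, map_zero] at c01 c10
  exact ⟨c00, c01, c10, c11⟩

/-- **Monotonicity of `M_N` in `N`** at the level of generators (`Γ(N') ≤ Γ(N)` for `N ∣ N'`); in
particular `M_2 ⊆ M_N` for even `N`. [cite: CalegariDimitrovTang2025, Lemma 4.2.3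
("injective algebra maps `M_2 → M_N → R_N`")] -/
theorem levelGens_mono {N N' : ℕ} (hN : 0 < N) (hd : N ∣ N') (hN' : N' ≠ 0) :
    levelGens N ⊆ levelGens N' := by
  rintro u ⟨G, hG, m, F, hle, hint, rfl⟩
  have hTN : T ^ N ∈ G := by
    refine hle ?_
    have h := CongruenceSubgroup.ModularGroup_T_pow_mem_Gamma N N dvd_rfl
    rwa [Int.natAbs_natCast, zpow_natCast] at h
  exact ⟨G, hG, m, F, (Gamma_le_Gamma_of_dvd hd).trans hle,
    forall_coeff_int_of_dvd F hN hTN hd hN' hint, rfl⟩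

/-- `R_N ⊆ R_{N'}` for `N ∣ N'`. [cite: CalegariDimitrovTang2025, §4.3] -/
theorem bddDenField_mono {N N' : ℕ} (hN : 0 < N) (hd : N ∣ N') (hN' : N' ≠ 0) :
    bddDenField N ≤ bddDenField N' :=
  IntermediateField.adjoin.mono ℂ _ _ (bddDenGens_mono hN hd hN')

/-- `M_N ⊆ M_{N'}` for `N ∣ N'`. [cite: CalegariDimitrovTang2025, Lemma 4.2.3] -/
theorem levelField_mono {N N' : ℕ} (hN : 0 < N) (hd : N ∣ N') (hN' : N' ≠ 0) :
    levelField N ≤ levelField N' :=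
  IntermediateField.adjoin.mono ℂ _ _ (levelGens_mono hN hd hN')

/-- The generators of `M_N` are `Γ(N)`-invariant. [cite: CalegariDimitrovTang2025, Definition 4.2.1] -/
theorem levelGens_subset_invariantField (N : ℕ) :
    levelGens N ⊆ (invariantField (Gamma N) : Set Mer) := by
  rintro u ⟨G, hG, m, F, hle, -, rfl⟩
  refine mem_invariantField_iff.mpr fun γ hγ ↦ ?_
  rw [smul_algebraMap, smul_modFun_of_mem F (hle hγ)]

/-- **Every element of `M_N` is `Γ(N)`-invariant**: `M_N ≤ Mer^{Γ(N)}` (a field generated by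
`Γ(N)`-fixed elements is `Γ(N)`-fixed). [cite: CalegariDimitrovTang2025, Definition 4.2.1 and
Lemma 4.2.3 ("`M_N` may be identified with the field of rational functions on the modular curve
`Y(N)`")] -/
theorem levelField_le_invariantField (N : ℕ) : levelField N ≤ invariantField (Gamma N) :=
  IntermediateField.adjoin_le_iff.mpr (levelGens_subset_invariantField N)

/-- The generators of `R_N` attached to a group `G` are `G`-invariant.
[cite: CalegariDimitrovTang2025, Lemma 4.2.3] -/
theorem algebraMap_modFun_mem_invariantField {G : Subgroup SL(2, ℤ)} {m : ℕ}
    (F : ModularForm (G : Subgroup (GL (Fin 2) ℝ)) (12 * (m : ℤ))) :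
    algebraMap hol Mer (modFun m F) ∈ invariantField G :=
  mem_invariantField_iff.mpr fun γ hγ ↦ by rw [smul_algebraMap, smul_modFun_of_mem F hγ]

/-! ### §5. Entrance and exit of the core case; the reduction `R_N = M_N ⟹ Theorem 1.0.1` -/

/-- **Entrance.** In the core case of the unbounded denominators theorem
(`CalegariDimitrovTang2025_unboundedDenominators.iff_core_wohlfahrtLevel`: `G` of finite index
containing every conjugate of `Tᴺ`, `f ∈ M_{12m}(G)` with `f ∈ ℤ⟦q_N⟧`), the modular function `f/Δᵐ`
is one of CDT's generators of `R_N`. [cite: CalegariDimitrovTang2025, §4.2 (Definition 4.2.1) and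
§6.3] -/
theorem algebraMap_modFun_mem_bddDenGens {G : Subgroup SL(2, ℤ)} [hG : G.FiniteIndex] {N : ℕ}
    (hT : ∀ g : SL(2, ℤ), g * T ^ N * g⁻¹ ∈ G) {m : ℕ}
    (F : ModularForm (G : Subgroup (GL (Fin 2) ℝ)) (12 * (m : ℤ)))
    (hint : ∀ n : ℕ, ∃ z : ℤ, PowerSeries.coeff n (qExpansion (N : ℝ) F) = (z : ℂ)) :
    algebraMap hol Mer (modFun m F) ∈ bddDenGens N :=
  ⟨G, hG, m, F, hT, hint, rfl⟩

/-- The same, into the field `R_N`. [cite: CalegariDimitrovTang2025, §4.2 and §6.3] -/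
theorem algebraMap_modFun_mem_bddDenField {G : Subgroup SL(2, ℤ)} [G.FiniteIndex] {N : ℕ}
    (hT : ∀ g : SL(2, ℤ), g * T ^ N * g⁻¹ ∈ G) {m : ℕ}
    (F : ModularForm (G : Subgroup (GL (Fin 2) ℝ)) (12 * (m : ℤ)))
    (hint : ∀ n : ℕ, ∃ z : ℤ, PowerSeries.coeff n (qExpansion (N : ℝ) F) = (z : ℂ)) :
    algebraMap hol Mer (modFun m F) ∈ bddDenField N :=
  IntermediateField.subset_adjoin ℂ _ (algebraMap_modFun_mem_bddDenGens hT F hint)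

/-- **Exit.** If the modular function `f/Δᵐ` of a weight-`12m` form `f` on a finite-index
`G ≤ SL(2, ℤ)` is `Γ(N)`-invariant in `Mer` (`N ≠ 0`) — in particular if it lies in `M_N` — then `f`
is `Γ(N)`-invariant in weight `12m`, hence a modular form on the congruence subgroup `Γ(N)`
(`exists_congruence_modularForm_coe_eq_iff`). This is the last sentence of CDT's proof: "`R_N = M_N`
for every `N`, that is, the unbounded denominators conjecture holds."
[cite: CalegariDimitrovTang2025, §6.3] -/
theorem exists_congruence_of_algebraMap_modFun_mem_invariantField {G : Subgroup SL(2, ℤ)}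
    [G.FiniteIndex] {N : ℕ} (hN : N ≠ 0) {m : ℕ}
    (F : ModularForm (G : Subgroup (GL (Fin 2) ℝ)) (12 * (m : ℤ)))
    (hmem : algebraMap hol Mer (modFun m F) ∈ invariantField (Gamma N)) :
    ∃ (Γ' : Subgroup SL(2, ℤ)) (g : ModularForm (Γ' : Subgroup (GL (Fin 2) ℝ)) (12 * (m : ℤ))),
      IsCongruenceSubgroup Γ' ∧ (g : ℍ → ℂ) = F := by
  refine (exists_congruence_modularForm_coe_eq_iff F).mpr ⟨N, hN, fun γ hγ ↦ ?_⟩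
  have hinv : ∀ γ ∈ Gamma N, γ • modFun m F = modFun m F := fun γ hγ ↦
    algebraMap_hol_injective (by rw [← smul_algebraMap]; exact mem_invariantField_iff.mp hmem γ hγ)
  exact slash_eq_of_forall_smul_modFun_eq F hinv hγ

/-- **Exit, `M_N` form.** If `f/Δᵐ ∈ M_N` then `f` is congruence.
[cite: CalegariDimitrovTang2025, §6.3] -/
theorem exists_congruence_of_algebraMap_modFun_mem_levelField {G : Subgroup SL(2, ℤ)}
    [G.FiniteIndex] {N : ℕ} (hN : N ≠ 0) {m : ℕ}
    (F : ModularForm (G : Subgroup (GL (Fin 2) ℝ)) (12 * (m : ℤ)))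
    (hmem : algebraMap hol Mer (modFun m F) ∈ levelField N) :
    ∃ (Γ' : Subgroup SL(2, ℤ)) (g : ModularForm (Γ' : Subgroup (GL (Fin 2) ℝ)) (12 * (m : ℤ))),
      IsCongruenceSubgroup Γ' ∧ (g : ℍ → ℂ) = F :=
  exists_congruence_of_algebraMap_modFun_mem_invariantField hN F
    (levelField_le_invariantField N hmem)

/-- ★ **The unbounded denominators theorem follows from `R_N ⊆ M_N` for all even `N`** — the shape
in which Calegari–Dimitrov–Tang prove it (§4.2: "Our goal is to prove that `R_N = M_N`. We can and do
assume that `N` is even"; §6.3: "`R_N = M_N` for every `N`, that is, the unbounded denominators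
conjecture holds"), here with the `ℂ`-spans of their generators. Proof: by
`…iff_core_wohlfahrtLevel` it suffices to treat `f ∈ M_{12m}(G)`, `G` normal of finite index with
all conjugates of `T^{L(G)}` and `f ∈ ℤ⟦q_{L(G)}⟧`; then `f/Δᵐ ∈ R_{L(G)} ⊆ R_{2L(G)} ⊆ M_{2L(G)}`,
whose elements are `Γ(2L(G))`-invariant, so `f` is congruence by the exit lemma.
[cite: CalegariDimitrovTang2025, §4.2 and §6.3] -/
theorem _root_.Literature.NumberTheory.Automorphic.CalegariDimitrovTang2025_unboundedDenominators.of_bddDenField_le_levelField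
    (H : ∀ N : ℕ, 0 < N → Even N → bddDenField N ≤ levelField N) :
    CalegariDimitrovTang2025_unboundedDenominators := by
  refine CalegariDimitrovTang2025_unboundedDenominators.iff_core_wohlfahrtLevel.mpr
    fun G _ _ _ _ _ m _ f _ hint ↦ ?_
  set N := wohlfahrtLevel G with hNdef
  have hN : 0 < N := wohlfahrtLevel_pos G
  have hT : ∀ g : SL(2, ℤ), g * T ^ N * g⁻¹ ∈ G := conj_T_pow_wohlfahrtLevel_mem G
  have h2N : (2 * N) ≠ 0 := by omega
  have hmemR : algebraMap hol Mer (modFun m f) ∈ bddDenField (2 * N) :=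
    bddDenField_mono hN (Dvd.intro_left 2 rfl) h2N (algebraMap_modFun_mem_bddDenField hT f hint)
  exact exists_congruence_of_algebraMap_modFun_mem_levelField h2N f
    (H (2 * N) (by omega) (even_two_mul N) hmemR)

end UnboundedDenominators

end Literature.NumberTheory.Automorphic

end
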